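/-
Origin: expansion seat `planner-pub-hodgecm-mc-theta-3-g8-0`, handover #1 10:47Z md5 df75ee09e750 (223 l.; = theta-3-g6 draft rev. 2 1a6bbcecf64e with the header's DRAFT paragraph replaced by the staging note, body byte-identical; NEW additive PKG Model leaf, ns HodgeCM.Model.ArchKTypeData; imports `HodgeCM.Model.ThetaHolDirections` + the three group (p) twins above. 5 theorems: § 1 `ArchKTypeData.isWeaklyPDiff_of_junction` ((AN) along a chart from a twisted junction datum `hW₁`/`hvac₁`/`χc`/`L`/`Φ₁`/`hΦ`/`hω`, by tree `RealDualPair.differentiableAt_charTwist_expP`), `isPMinusKilledAlong_of_junction` ((REP) along `-I • e_p` from the harmonicity relation `hf`, by tree `RealDualPair.weilDatum_pMinus_expP_map` for `hW₁.twist χc hχc`), `isPMinusKilledAlong_of_junction'` (END-STATE shape `∀ p`); § 2 `isWeaklyPDiff_of_blockPair` / `isPMinusKilledAlong_of_blockPair` (χ and L INTERNAL: binders = big archimedean datum `hW`/`hc` on `𝓢(ℝ^{DPIdx (Fin 2) Unit R S ⊕ σ₂})`, junction datum `hW₁`/`hc₁` (+ `hvac₁` for AN), block inclusion `s`/`hs_cont`/`hs`,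 chart `e`, intertwiner `τ` + `hτ` along the chart, `Φ₂`/`Φ₁`/`hΦ : B.Φarch ℓ = τ (sumProdLeftCLM Φ₂ (Φ₁ ℓ))` (+ `hf` for REP), via tree `IsArchWeilDatum.exists_circle_twist_factorisation_clm` p185623). 0 defs, 0 Prop defs, 0 records, 0 cited binders, nothing minted, MODEL-N ±0. EVIDENCE (against p-g11's RUN-35 in-place PKG world, K-1 twins' oleans of 10:36–10:41Z): PKG-env loose `lake env lean` rc 0 / 0 warnings / 0 errors (12.7 s; `work/loose-ArchKTypeJunction-3.log` empty), private olean build rc 0 (699552 B, `olean/HodgeCM/Model/ArchKTypeJunction.olean`), `#print axioms` 5/5 = [propext, Classical.choice, Quot.sound] (`work/ax-ArchKTypeJunction.log`, scratch `lean/scratch/ax_ArchKTypeJunction.lean`), 0 proof holes (the one «proof-hole» string of the g6 draft header comment removed). Consumers: none yet in PKG (its instantiation = BRICK4-SPEC §3 residuals (a)(b)(c) + (C-harm∞-chk), RUN 36+).) (`HOME/mc/pub-hodgecm-mc-theta-3-g8/lean/stage/HodgeCM/Model/ArchKTypeJunction.lean`, md5 df75ee09, 223 lines);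
landed by the gen-12 packager (p-g12) in gate run 36 as `HodgeCM/Model/ArchKTypeJunction.lean` (verbatim).
-/
/-
Copyright (c) 2026. Released under Apache 2.0 license as described in the file LICENSE.
Cell pub-hodgecm, MODEL layer (construction prover mc-theta-3, gen 6), node W6b-hol (ASM) / model item (T-j) of
`MODEL-DAG.md`: E's END-STATE binders (AN) `IsWeaklyPDiff` and (REP) `IsPMinusKilledAlong` for an archimedean
`K`-type datum intertwined with a (twisted) junction Weil datum of `U(2,1) × U(R,S)`.
Staged 2026-08-19 by mc-theta-3 gen 8 from the gen-6 draft (1a6bbcecf64e): imports the three K-1 group (p) twins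
installed in gate run 35; the junction-side plumbing was first farm-validated verbatim over a stand-in structure in
`mc/pub-hodgecm-mc-theta-3-g6/lean/scratch/Brick4Shape{,Block}.lean` (hub `lean check` rc 0, no proof holes, axioms
{propext, Classical.choice, Quot.sound}).
-/
import Summits.HodgeConjecture.HodgeCM.Model.ThetaHolDirections
import Literature.RepresentationTheory.KonnoKonno2007.JunctionCharacterSmooth
import Literature.RepresentationTheory.KonnoKonno2007.JunctionPMinusBallFrame
import Literature.NumberTheory.Weil1964.ArchWeilDatumFactorisationTransport

/-!
# (AN) and (REP) from a junction Weil datum through an intertwiner (W6b-hol (ASM), model item (T-j))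

E's holomorphy binders at the pin are (AN) `C.IsWeaklyPDiff BallForms.expP` and (REP)
`∀ p, C.IsPMinusKilledAlong BallForms.expP (-I • e_p)` (`Model/ThetaHolDirections`,
`classPacksOf_pin_of_isPMinusKilledAlong`; consumed by `Model/E2InstanceR15A`).  Both only evaluate
`C.ωinf (e b)` on the harmonic vectors `C.Φarch ℓ`.  Suppose these come from the LOCAL junction model at the one
non-compact place through a continuous `ℂ`-linear map
`L : 𝓢(ℝ^{DPIdx (Fin 2) Unit R S}) →L[ℂ] 𝓢((X.J → K_∞), ℂ)` (for `g ≥ 2`: `Φ₁ ↦ frame (Φ₁ ⊠ Φ_cpt)`, the tree's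
`SchwartzMap.sumProdLeftCLM` + a coordinate frame):
(i) `C.Φarch ℓ = L (Φ₁ ℓ)` and (ii) along the chart `b ↦ (u21FrameEquiv (expP b), 1)` of `𝔭`,
`C.ωinf (e b) (L (Φ₁ ℓ)) = L ((χ ⊗ ω₁) (u21FrameEquiv (expP b), 1) (Φ₁ ℓ))` for an archimedean Weil datum `ω₁` of the
dual pair `U(2,1) × U(R,S)` (tree `IsArchWeilDatum (ι𝕎 (Fin 2) Unit R S) ω₁`) twisted by a continuous unitary character
`χ` (tree `charTwist`; this is EXACTLY the shape delivered by the archimedean factorisation at product vectors,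
tree `IsArchWeilDatum.exists_twist_factorisation` / `IsBlockPair.apply_tensorPi_eq_twist`, with `χ` the factor
character `IsBlockPair.factorCharCircle`).  Then:

* **`ArchKTypeData.isWeaklyPDiff_of_junction`** — (AN) holds along `e`, by AN-D under a character twist
  (tree `RealDualPair.differentiableAt_charTwist_expP`, [Varadarajan 1984, Thm. 2.11.2; Folland 1989, Prop. 4.39])
  applied to the real-linear functional `(T ∘ L)|_ℝ`; needs the vacuum line `hvac₁` of `ω₁`.
* **`ArchKTypeData.isPMinusKilledAlong_of_junction`** — (REP) holds along `e` in the direction `-I • e_p` whenever the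
  local vectors satisfy the harmonicity relation `hypOpGen_p Φ₁(ℓ) + i rotBoostGen_p(π/2) Φ₁(ℓ) = 0`, by the tree's
  `RealDualPair.weilDatum_pMinus_expP_map` [Folland 1989, Prop. (4.39), (4.24)] for the twisted datum
  (`IsArchWeilDatum.twist`: a twist by a continuous circle character is again a datum over the same `ι𝕎`);
  `isPMinusKilledAlong_of_junction'` is the END-STATE shape `∀ p`.

* § 2 **`ArchKTypeData.isWeaklyPDiff_of_blockPair`**, **`ArchKTypeData.isPMinusKilledAlong_of_blockPair`** — the
  hypotheses `χ, L, (ii)` DISCHARGED by the archimedean factorisation (tree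
  `IsArchWeilDatum.exists_circle_twist_factorisation_clm`, [Folland 1989, Prop. (1.43), (4.23)]): given the BIG
  archimedean datum `ω` of a group `G` on `𝓢(ℝ^{DPIdx ⊕ σ₂})` with continuous operators, the w₁-inclusion
  `s : U(2,1) × U(R,S) →* G` (continuous, block-diagonal with identity second block under the symplectic images),
  an intertwiner `τ : 𝓢(ℝ^{DPIdx ⊕ σ₂}) →L[ℂ] 𝓢((X.J → K_∞), ℂ)` with `C.ωinf (e b) (τ x) = τ (ω (s (u21FrameEquiv
  (expP b), 1)) x)`, and `C.Φarch ℓ = τ (Φ₁ ℓ ⊠ Φ₂)`; then (AN) needs only `hvac₁`, and (REP) only the harmonicity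
  relations `hf`.

Instances of the harmonicity relation in the tree (all `S = ∅`): `hypOpGen_add_I_smul_rotBoostGen_hermitePi_zero`,
`…_degOne`, `…_degOneP` (via `weilDatum_pMinus_expP_degOneP`), `…_binvPi_eq_zero`.
Nothing is cited as a hypothesis and nothing is minted: kernel lemmas over the installed definitions; the bracketed
references are provenance of the tree theorems used.
-/

set_option autoImplicit false

noncomputable section

open Filter Topology Complex
open scoped Classical SchwartzMap
open MulAction NumberField.mixedEmbedding
open Literature.NumberTheory.Automorphic Literature.NumberTheory.Weil1964 Literature.Analysis.SegalBargmann
open Literature.AlgebraicGeometry.HodgeTheory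
open Literature.AlgebraicGeometry.ShimuraVarieties Literature.AlgebraicGeometry.ShimuraVarieties.BallForms
open Literature.Geometry.ComplexHyperbolic.BallModel
open Literature.RepresentationTheory.KonnoKonno2007 Literature.RepresentationTheory.KonnoKonno2007.RealDualPair
open Literature.NumberTheory.Automorphic.PicardCM Literature.Analysis.Distribution
open Literature.RepresentationTheory.HeisenbergGroup
open HodgeCM.PerL34.Seesaw HodgeCM.PerL34.RationalCoset HodgeCM.PerL34.SupplyAdelic
open HodgeCM.Model.SupplyInstance HodgeCM.Model.SupplyResidual
open HodgeCM.Model.ThetaSpace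

namespace HodgeCM
namespace Model

section ArchJunction

variable {U : Universe} {Lc : CMField} {ι₁ : Lc →+* ℂ} {V : HermSpace3 Lc ι₁} {c : SeesawCtx Lc}

namespace ArchKTypeData

variable {X : ThetaSpaceInput U V c} {k : Fin 4} {N : ℕ} (B : ArchKTypeData X k N)
variable {R S : Type} [Fintype R] [DecidableEq R] [Fintype S] [DecidableEq S]

set_option backward.isDefEq.respectTransparency false in
/-- **(AN) for an archimedean `K`-type datum intertwined with a twisted junction datum** along any chart
`e : ℂ² → G₁` factoring through `b ↦ (u21FrameEquiv (expP b), 1)` on the harmonic vectors. -/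
theorem isWeaklyPDiff_of_junction
    {ω₁ : Representation ℂ (Ginf (Fin 2) Unit R S) (SchwartzMap (DPIdx (Fin 2) Unit R S → ℝ) ℂ)}
    (hW₁ : IsArchWeilDatum (ι𝕎 (Fin 2) Unit R S) ω₁) {ev : VacExponents}
    (hvac₁ : ∀ kk : DPK (Fin 2) Unit R S, ω₁ (κ (Fin 2) Unit R S kk) (hermitePi 0) = vacScalar ev kk • hermitePi 0)
    (χc : Ginf (Fin 2) Unit R S →* Circle) (hχc : Continuous χc)
    (e : (Fin 2 → ℂ) → X.G₁)
    (L : SchwartzMap (DPIdx (Fin 2) Unit R S → ℝ) ℂ →L[ℂ] 𝓢((X.J → mixedSpace X.K), ℂ))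
    (Φ₁ : Module.Dual ℂ X.W → SchwartzMap (DPIdx (Fin 2) Unit R S → ℝ) ℂ)
    (hΦ : ∀ ℓ, B.Φarch ℓ = L (Φ₁ ℓ))
    (hω : ∀ (b : Fin 2 → ℂ) (ℓ : Module.Dual ℂ X.W), B.ωinf (e b) (L (Φ₁ ℓ)) =
      L (charTwist (Circle.coeHom.comp χc) ω₁
        (((u21FrameEquiv (expP b) : UForm (Fin 2) Unit), (1 : UForm R S)) : Ginf (Fin 2) Unit R S) (Φ₁ ℓ))) :
    B.IsWeaklyPDiff e := by
  intro T ℓ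
  have hχ : Continuous (Circle.coeHom.comp χc : Ginf (Fin 2) Unit R S →* ℂ) := continuous_subtype_val.comp hχc
  have h := differentiableAt_charTwist_expP (V := ℂ) hW₁ hvac₁ hχ ((T.comp L).restrictScalars ℝ) (Φ₁ ℓ) 0
  refine h.congr_of_eventuallyEq (Filter.Eventually.of_forall fun b => ?_)
  simp only [hΦ, hω, ContinuousLinearMap.coe_restrictScalars', ContinuousLinearMap.coe_comp,
    Function.comp_apply]

set_option backward.isDefEq.respectTransparency false in
/-- **(REP) along `-i e_p` for an archimedean `K`-type datum intertwined with a twisted junction datum**, from the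
harmonicity relation of the local vectors. -/
theorem isPMinusKilledAlong_of_junction
    {ω₁ : Representation ℂ (Ginf (Fin 2) Unit R S) (SchwartzMap (DPIdx (Fin 2) Unit R S → ℝ) ℂ)}
    (hW₁ : IsArchWeilDatum (ι𝕎 (Fin 2) Unit R S) ω₁)
    (χc : Ginf (Fin 2) Unit R S →* Circle) (hχc : Continuous χc)
    (e : (Fin 2 → ℂ) → X.G₁)
    (L : SchwartzMap (DPIdx (Fin 2) Unit R S → ℝ) ℂ →L[ℂ] 𝓢((X.J → mixedSpace X.K), ℂ))
    (Φ₁ : Module.Dual ℂ X.W → SchwartzMap (DPIdx (Fin 2) Unit R S → ℝ) ℂ)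
    (hΦ : ∀ ℓ, B.Φarch ℓ = L (Φ₁ ℓ))
    (hω : ∀ (b : Fin 2 → ℂ) (ℓ : Module.Dual ℂ X.W), B.ωinf (e b) (L (Φ₁ ℓ)) =
      L (charTwist (Circle.coeHom.comp χc) ω₁
        (((u21FrameEquiv (expP b) : UForm (Fin 2) Unit), (1 : UForm R S)) : Ginf (Fin 2) Unit R S) (Φ₁ ℓ)))
    (p : Fin 2)
    (hf : ∀ ℓ, hypOpGen R S p () (Φ₁ ℓ) + I • rotBoostGen R S p () (Real.pi / 2) (Φ₁ ℓ) = 0) :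
    B.IsPMinusKilledAlong e (-Complex.I • (Pi.single p 1 : Fin 2 → ℂ)) := by
  intro ℓ
  obtain ⟨D, Dᵢ, h₁, h₂, h₃⟩ := weilDatum_pMinus_expP_map (hW₁.twist χc hχc) p (Φ₁ ℓ) (hf ℓ) L
  refine ⟨D, Dᵢ, ?_, ?_, h₃⟩
  · simpa only [hΦ, hω] using h₁
  · simpa only [hΦ, hω] using h₂

/-- **(REP) in the END-STATE shape** `∀ p, C.IsPMinusKilledAlong e (-I • e_p)` (the `hk` binder of
`classPacksOf_pin_of_isPMinusKilledAlong` / `Model/E2InstanceR15A` at `e = BallForms.expP`). -/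
theorem isPMinusKilledAlong_of_junction'
    {ω₁ : Representation ℂ (Ginf (Fin 2) Unit R S) (SchwartzMap (DPIdx (Fin 2) Unit R S → ℝ) ℂ)}
    (hW₁ : IsArchWeilDatum (ι𝕎 (Fin 2) Unit R S) ω₁)
    (χc : Ginf (Fin 2) Unit R S →* Circle) (hχc : Continuous χc)
    (e : (Fin 2 → ℂ) → X.G₁)
    (L : SchwartzMap (DPIdx (Fin 2) Unit R S → ℝ) ℂ →L[ℂ] 𝓢((X.J → mixedSpace X.K), ℂ))
    (Φ₁ : Module.Dual ℂ X.W → SchwartzMap (DPIdx (Fin 2) Unit R S → ℝ) ℂ)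
    (hΦ : ∀ ℓ, B.Φarch ℓ = L (Φ₁ ℓ))
    (hω : ∀ (b : Fin 2 → ℂ) (ℓ : Module.Dual ℂ X.W), B.ωinf (e b) (L (Φ₁ ℓ)) =
      L (charTwist (Circle.coeHom.comp χc) ω₁
        (((u21FrameEquiv (expP b) : UForm (Fin 2) Unit), (1 : UForm R S)) : Ginf (Fin 2) Unit R S) (Φ₁ ℓ)))
    (hf : ∀ (p : Fin 2) ℓ, hypOpGen R S p () (Φ₁ ℓ) + I • rotBoostGen R S p () (Real.pi / 2) (Φ₁ ℓ) = 0) :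
    ∀ p : Fin 2, B.IsPMinusKilledAlong e (-Complex.I • (Pi.single p 1 : Fin 2 → ℂ)) := fun p =>
  B.isPMinusKilledAlong_of_junction hW₁ χc hχc e L Φ₁ hΦ hω p (hf p)

/-! ### § 2 From the big archimedean datum: `χ`, `L` and the intertwining discharged by the factorisation -/

set_option backward.isDefEq.respectTransparency false in
/-- **(AN) from the big archimedean datum** `ω` of `G` on `𝓢(ℝ^{DPIdx ⊕ σ₂})`, the block inclusion `s` of
`U(2,1) × U(R,S)`, an intertwiner `τ` into `C.ωinf` along the chart, and `Φarch ℓ = τ (Φ₁ ℓ ⊠ Φ₂)`. -/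
theorem isWeaklyPDiff_of_blockPair {σ₂ : Type} [Fintype σ₂] [DecidableEq σ₂]
    {G : Type} [Group G] [TopologicalSpace G]
    {ι𝕎' : G →* symplecticGroup (polar (dotPairing (DPIdx (Fin 2) Unit R S ⊕ σ₂)))}
    {ω : Representation ℂ G (SchwartzMap (DPIdx (Fin 2) Unit R S ⊕ σ₂ → ℝ) ℂ)} (hW : IsArchWeilDatum ι𝕎' ω)
    (hc : ∀ g, Continuous (ω g))
    {ω₁ : Representation ℂ (Ginf (Fin 2) Unit R S) (SchwartzMap (DPIdx (Fin 2) Unit R S → ℝ) ℂ)}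
    (hW₁ : IsArchWeilDatum (ι𝕎 (Fin 2) Unit R S) ω₁) (hc₁ : ∀ u, Continuous (ω₁ u)) {ev : VacExponents}
    (hvac₁ : ∀ kk : DPK (Fin 2) Unit R S, ω₁ (κ (Fin 2) Unit R S kk) (hermitePi 0) = vacScalar ev kk • hermitePi 0)
    (s : Ginf (Fin 2) Unit R S →* G) (hs_cont : Continuous s)
    (hs : ∀ u, (⇑((ι𝕎' (s u)).1 :
        ((DPIdx (Fin 2) Unit R S ⊕ σ₂ → ℝ) × (DPIdx (Fin 2) Unit R S ⊕ σ₂ → ℝ)) ≃ₗ[ℝ]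
          (DPIdx (Fin 2) Unit R S ⊕ σ₂ → ℝ) × (DPIdx (Fin 2) Unit R S ⊕ σ₂ → ℝ)) :
        PhaseMap (DPIdx (Fin 2) Unit R S ⊕ σ₂)) =
      blockPhase (⇑((ι𝕎 (Fin 2) Unit R S u).1 :
        ((DPIdx (Fin 2) Unit R S → ℝ) × (DPIdx (Fin 2) Unit R S → ℝ)) ≃ₗ[ℝ]
          (DPIdx (Fin 2) Unit R S → ℝ) × (DPIdx (Fin 2) Unit R S → ℝ))) id)
    (e : (Fin 2 → ℂ) → X.G₁)
    (τ : SchwartzMap (DPIdx (Fin 2) Unit R S ⊕ σ₂ → ℝ) ℂ →L[ℂ] 𝓢((X.J → mixedSpace X.K), ℂ))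
    (hτ : ∀ (b : Fin 2 → ℂ) (x : SchwartzMap (DPIdx (Fin 2) Unit R S ⊕ σ₂ → ℝ) ℂ), B.ωinf (e b) (τ x) =
      τ (ω (s (((u21FrameEquiv (expP b) : UForm (Fin 2) Unit), (1 : UForm R S)) : Ginf (Fin 2) Unit R S)) x))
    (Φ₂ : SchwartzMap (σ₂ → ℝ) ℂ) (Φ₁ : Module.Dual ℂ X.W → SchwartzMap (DPIdx (Fin 2) Unit R S → ℝ) ℂ)
    (hΦ : ∀ ℓ, B.Φarch ℓ = τ (SchwartzMap.sumProdLeftCLM Φ₂ (Φ₁ ℓ))) :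
    B.IsWeaklyPDiff e := by
  obtain ⟨χc, hχc, hω⟩ := hW.exists_circle_twist_factorisation_clm hc hW₁ hc₁ s hs_cont hs τ
    (fun b => B.ωinf (e b))
    (fun b => (((u21FrameEquiv (expP b) : UForm (Fin 2) Unit), (1 : UForm R S)) : Ginf (Fin 2) Unit R S)) hτ Φ₂
  exact B.isWeaklyPDiff_of_junction hW₁ hvac₁ χc hχc e (τ.comp (SchwartzMap.sumProdLeftCLM Φ₂)) Φ₁
    (fun ℓ => hΦ ℓ) (fun b ℓ => hω b (Φ₁ ℓ))

set_option backward.isDefEq.respectTransparency false in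
/-- **(REP) along both `-i e_p` from the big archimedean datum**, given the harmonicity relations of the local
vectors `Φ₁ ℓ`. -/
theorem isPMinusKilledAlong_of_blockPair {σ₂ : Type} [Fintype σ₂] [DecidableEq σ₂]
    {G : Type} [Group G] [TopologicalSpace G]
    {ι𝕎' : G →* symplecticGroup (polar (dotPairing (DPIdx (Fin 2) Unit R S ⊕ σ₂)))}
    {ω : Representation ℂ G (SchwartzMap (DPIdx (Fin 2) Unit R S ⊕ σ₂ → ℝ) ℂ)} (hW : IsArchWeilDatum ι𝕎' ω)
    (hc : ∀ g, Continuous (ω g))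
    {ω₁ : Representation ℂ (Ginf (Fin 2) Unit R S) (SchwartzMap (DPIdx (Fin 2) Unit R S → ℝ) ℂ)}
    (hW₁ : IsArchWeilDatum (ι𝕎 (Fin 2) Unit R S) ω₁) (hc₁ : ∀ u, Continuous (ω₁ u))
    (s : Ginf (Fin 2) Unit R S →* G) (hs_cont : Continuous s)
    (hs : ∀ u, (⇑((ι𝕎' (s u)).1 :
        ((DPIdx (Fin 2) Unit R S ⊕ σ₂ → ℝ) × (DPIdx (Fin 2) Unit R S ⊕ σ₂ → ℝ)) ≃ₗ[ℝ]
          (DPIdx (Fin 2) Unit R S ⊕ σ₂ → ℝ) × (DPIdx (Fin 2) Unit R S ⊕ σ₂ → ℝ)) :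
        PhaseMap (DPIdx (Fin 2) Unit R S ⊕ σ₂)) =
      blockPhase (⇑((ι𝕎 (Fin 2) Unit R S u).1 :
        ((DPIdx (Fin 2) Unit R S → ℝ) × (DPIdx (Fin 2) Unit R S → ℝ)) ≃ₗ[ℝ]
          (DPIdx (Fin 2) Unit R S → ℝ) × (DPIdx (Fin 2) Unit R S → ℝ))) id)
    (e : (Fin 2 → ℂ) → X.G₁)
    (τ : SchwartzMap (DPIdx (Fin 2) Unit R S ⊕ σ₂ → ℝ) ℂ →L[ℂ] 𝓢((X.J → mixedSpace X.K), ℂ))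
    (hτ : ∀ (b : Fin 2 → ℂ) (x : SchwartzMap (DPIdx (Fin 2) Unit R S ⊕ σ₂ → ℝ) ℂ), B.ωinf (e b) (τ x) =
      τ (ω (s (((u21FrameEquiv (expP b) : UForm (Fin 2) Unit), (1 : UForm R S)) : Ginf (Fin 2) Unit R S)) x))
    (Φ₂ : SchwartzMap (σ₂ → ℝ) ℂ) (Φ₁ : Module.Dual ℂ X.W → SchwartzMap (DPIdx (Fin 2) Unit R S → ℝ) ℂ)
    (hΦ : ∀ ℓ, B.Φarch ℓ = τ (SchwartzMap.sumProdLeftCLM Φ₂ (Φ₁ ℓ)))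
    (hf : ∀ (p : Fin 2) ℓ, hypOpGen R S p () (Φ₁ ℓ) + I • rotBoostGen R S p () (Real.pi / 2) (Φ₁ ℓ) = 0) :
    ∀ p : Fin 2, B.IsPMinusKilledAlong e (-Complex.I • (Pi.single p 1 : Fin 2 → ℂ)) := by
  obtain ⟨χc, hχc, hω⟩ := hW.exists_circle_twist_factorisation_clm hc hW₁ hc₁ s hs_cont hs τ
    (fun b => B.ωinf (e b))
    (fun b => (((u21FrameEquiv (expP b) : UForm (Fin 2) Unit), (1 : UForm R S)) : Ginf (Fin 2) Unit R S)) hτ Φ₂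
  exact B.isPMinusKilledAlong_of_junction' hW₁ χc hχc e (τ.comp (SchwartzMap.sumProdLeftCLM Φ₂)) Φ₁
    (fun ℓ => hΦ ℓ) (fun b ℓ => hω b (Φ₁ ℓ)) hf

end ArchKTypeData

end ArchJunction

end Model
end HodgeCM

end
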